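import Summits.BirchSwinnertonDyer.BirchSwinnertonDyer.Theorems.BiquadraticEisensteinDescentManinDatumSupercuspidalCMInertSevenDivisionGalois
import Summits.BirchSwinnertonDyer.BirchSwinnertonDyer.Theorems.BiquadraticEisensteinDescentManinDatumSupercuspidalCMInertValuedPowerSums
import Summits.BirchSwinnertonDyer.BirchSwinnertonDyer.Theorems.BiquadraticEisensteinDescentManinDatumSupercuspidalCMInertTorsionSumRationalSeven
import HarnessLib

set_option linter.dupNamespace false -- `Summit.BirchSwinnertonDyer.BirchSwinnertonDyer.Theorems.…` (summit = sub, D-0017)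
set_option autoImplicit false

/-!
# Crux `ManinDatumSupercuspidalCMInert` (stmt-BirchSwinnertonDyer-20111, BED r605), CM side of H₇ — step (d) of memo PLAIN-ODD-57,
# fourth brick (c): the `7`-division field `K₇ = ℚ(i)(E₀[7])` of `y² = x³ − x` has degree `48` over `ℚ(i)` and
# `Gal(K₇/ℚ(i)) ≅ (ℤ[i]/7)ˣ` — every `u ∈ (ℤ[i]/7)ˣ` is realised by an automorphism `σ_u : P_c ↦ P_{uc}`

Route `BiquadraticEisensteinDescent` (cell `pub/bsd-wall`, width seat `bsd-wall-cm-bed-w4` g11, RESOLVENT/GALOIS LANE; `--supports`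
stmt-BirchSwinnertonDyer-20111, helper). THEOREMS ONLY (no definition, no named fact, no `sorry`); nothing is closed by this file and BSD is
not proved by any of it.

`K₇ := ℚ⟮i⟯(X_c, Y_c : c ∈ ℤ[i] ∖ 7ℤ[i]) ⊂ ℂ` (Mathlib `IntermediateField.adjoin`), finite Galois over `ℚ⟮i⟯` (`…SevenDivisionGalois`). Here,
given ANY valuation `v` of `ℂ` with `v 7 < 1` (only used as a witness of total ramification):
* `finrank_ge` — `[K₇ : ℚ(i)] ≥ 48`: the powers `1, t_1, …, t_1⁴⁷` of `t_1 = X_1/Y_1` are `ℚ(i)`-linearly independent, because `v(t_1)⁴⁸ = v 7`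
  while `v(ℚ(i)ˣ) = v(7)^ℤ` (`…ValuedPowerSums.eq_zero_of_sum_mul_pow_eq_zero` — Eisenstein's criterion, valuation-theoretically);
* `exists_mul_of_algEquiv`, `algEquiv_eq_of_dvd_sub` — `σ ↦ u_σ (mod 7)` (`σ(P_c) = P_{u_σ c}`) is well defined and INJECTIVE on `Gal(K₇/ℚ(i))`;
* ★ `card_algEquiv` — `|Gal(K₇/ℚ(i))| = [K₇ : ℚ(i)] = 48`; ★ `exists_algEquiv_of_not_dvd` — **for every `u ∈ ℤ[i] ∖ 7ℤ[i]` there is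
  `σ ∈ Gal(K₇/ℚ(i))` with `σ(X_c) = X_{uc}`, `σ(Y_c) = Y_{uc}` for all `c`** (pigeonhole: `48` injects into the `48` non-zero classes);
* `exists_coeff_pow` — every element of `K₇` is `Σ_{j<48} a_j t_1^j` with `a_j ∈ ℚ(i)` (the power basis used for the isometry /
  residual-triviality hypotheses of `…TameResolvent.resolvent_valuation_le`).

References: [SilvermanATAEC1994] II.2, II.5 (Thm. 5.6: `Gal(K(E[𝔠])/K) ≅ (𝒪_K/𝔠)ˣ` for class number one); [Serre1979] Ch. I §6 Prop. 17–18;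
[SilvermanAEC2009] VIII.1.
-/

noncomputable section

open Complex PeriodPair Polynomial
open scoped PeriodPair IntermediateField
open Literature.NumberTheory.EllipticCurves Literature.NumberTheory.EllipticCurves.GaussianLattice
open Literature.NumberTheory.LFunctions.GaussianTheta

namespace Summit.BirchSwinnertonDyer.BirchSwinnertonDyer.Theorems.BiquadraticEisensteinDescentManinDatumSupercuspidalCMInertSevenDivisionGaloisCount

open Summit.BirchSwinnertonDyer.BirchSwinnertonDyer.Theorems.BiquadraticEisensteinDescentManinDatumSupercuspidalCMInertSevenDivisionPoints
open Summit.BirchSwinnertonDyer.BirchSwinnertonDyer.Theorems.BiquadraticEisensteinDescentManinDatumSupercuspidalCMInertSevenDivisionField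
open Summit.BirchSwinnertonDyer.BirchSwinnertonDyer.Theorems.BiquadraticEisensteinDescentManinDatumSupercuspidalCMInertSevenDivisionGalois
open Summit.BirchSwinnertonDyer.BirchSwinnertonDyer.Theorems.BiquadraticEisensteinDescentManinDatumSupercuspidalCMInertValuedPowerSums
  (eq_zero_of_sum_mul_pow_eq_zero)
open Summit.BirchSwinnertonDyer.BirchSwinnertonDyer.Theorems.BiquadraticEisensteinDescentManinDatumSupercuspidalCMInertTorsionSumRational
  (cls_eq_cls_iff)

/-! ## §7 Degree `48` and the Galois group `(ℤ[i]/7)ˣ` -/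

/-- **Every element of `Gal(K₇/ℚ(i))` acts on `E₀[7]` as multiplication by some `u ∈ (ℤ[i]/7)ˣ`**: `σ(X_c) = X_{uc}`, `σ(Y_c) = Y_{uc}`
(`…SevenDivisionGalois.exists_mul_of_algHom` for the embedding `K₇ ↪ ℂ` precomposed with `σ`). [cite: SilvermanATAEC1994, II.2 Thm. 2.3] -/
theorem exists_mul_of_algEquiv (σ : (IntermediateField.adjoin ℚ⟮I⟯ {x : ℂ | ∃ c : GaussianInt, ¬ (7 : GaussianInt) ∣ c ∧
        (x = ℘[ofUpperHalfPlane UpperHalfPlane.I] (((c : GaussianInt) : ℂ) / 7) / ((Real.Gamma (1 / 4) ^ 2 / (2 * Real.sqrt (2 * Real.pi)) : ℝ) : ℂ) ^ 2 ∨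
         x = ℘'[ofUpperHalfPlane UpperHalfPlane.I] (((c : GaussianInt) : ℂ) / 7) / (2 * ((Real.Gamma (1 / 4) ^ 2 / (2 * Real.sqrt (2 * Real.pi)) : ℝ) : ℂ) ^ 3))}) ≃ₐ[ℚ⟮I⟯]
             (IntermediateField.adjoin ℚ⟮I⟯ {x : ℂ | ∃ c : GaussianInt, ¬ (7 : GaussianInt) ∣ c ∧
        (x = ℘[ofUpperHalfPlane UpperHalfPlane.I] (((c : GaussianInt) : ℂ) / 7) / ((Real.Gamma (1 / 4) ^ 2 / (2 * Real.sqrt (2 * Real.pi)) : ℝ) : ℂ) ^ 2 ∨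
         x = ℘'[ofUpperHalfPlane UpperHalfPlane.I] (((c : GaussianInt) : ℂ) / 7) / (2 * ((Real.Gamma (1 / 4) ^ 2 / (2 * Real.sqrt (2 * Real.pi)) : ℝ) : ℂ) ^ 3))})) :
    ∃ u : GaussianInt, ¬ (7 : GaussianInt) ∣ u ∧ ∀ (c : GaussianInt) (hc : ¬ (7 : GaussianInt) ∣ c),
      ((σ ⟨_, X_mem_adjoin hc⟩ : (IntermediateField.adjoin ℚ⟮I⟯ {x : ℂ | ∃ c : GaussianInt, ¬ (7 : GaussianInt) ∣ c ∧
        (x = ℘[ofUpperHalfPlane UpperHalfPlane.I] (((c : GaussianInt) : ℂ) / 7) / ((Real.Gamma (1 / 4) ^ 2 / (2 * Real.sqrt (2 * Real.pi)) : ℝ) : ℂ) ^ 2 ∨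
         x = ℘'[ofUpperHalfPlane UpperHalfPlane.I] (((c : GaussianInt) : ℂ) / 7) / (2 * ((Real.Gamma (1 / 4) ^ 2 / (2 * Real.sqrt (2 * Real.pi)) : ℝ) : ℂ) ^ 3))})) : ℂ) =
             ℘[ofUpperHalfPlane UpperHalfPlane.I] (((u * c : GaussianInt) : ℂ) / 7) / ((Real.Gamma (1 / 4) ^ 2 / (2 * Real.sqrt (2 * Real.pi)) : ℝ) : ℂ) ^ 2 ∧
      ((σ ⟨_, Y_mem_adjoin hc⟩ : (IntermediateField.adjoin ℚ⟮I⟯ {x : ℂ | ∃ c : GaussianInt, ¬ (7 : GaussianInt) ∣ c ∧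
        (x = ℘[ofUpperHalfPlane UpperHalfPlane.I] (((c : GaussianInt) : ℂ) / 7) / ((Real.Gamma (1 / 4) ^ 2 / (2 * Real.sqrt (2 * Real.pi)) : ℝ) : ℂ) ^ 2 ∨
         x = ℘'[ofUpperHalfPlane UpperHalfPlane.I] (((c : GaussianInt) : ℂ) / 7) / (2 * ((Real.Gamma (1 / 4) ^ 2 / (2 * Real.sqrt (2 * Real.pi)) : ℝ) : ℂ) ^ 3))})) : ℂ) =
             ℘'[ofUpperHalfPlane UpperHalfPlane.I] (((u * c : GaussianInt) : ℂ) / 7) / (2 * ((Real.Gamma (1 / 4) ^ 2 / (2 * Real.sqrt (2 * Real.pi)) : ℝ) : ℂ) ^ 3) :=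
  exists_mul_of_algHom _ (fun _ hc ↦ X_mem_adjoin hc) (fun _ hc ↦ Y_mem_adjoin hc) (((IntermediateField.adjoin ℚ⟮I⟯ {x : ℂ | ∃ c : GaussianInt, ¬ (7 : GaussianInt) ∣ c ∧
        (x = ℘[ofUpperHalfPlane UpperHalfPlane.I] (((c : GaussianInt) : ℂ) / 7) / ((Real.Gamma (1 / 4) ^ 2 / (2 * Real.sqrt (2 * Real.pi)) : ℝ) : ℂ) ^ 2 ∨
         x = ℘'[ofUpperHalfPlane UpperHalfPlane.I] (((c : GaussianInt) : ℂ) / 7) / (2 * ((Real.Gamma (1 / 4) ^ 2 / (2 * Real.sqrt (2 * Real.pi)) : ℝ) : ℂ) ^ 3))})).val.comp σ.toAlgHom)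

/-- **The class `u_σ mod 7` determines `σ`**: two automorphisms acting on the division points through congruent multipliers agree
(they agree on the generators `X_c, Y_c` by `7`-periodicity). [folklore] -/
theorem algEquiv_eq_of_dvd_sub {σ τ : (IntermediateField.adjoin ℚ⟮I⟯ {x : ℂ | ∃ c : GaussianInt, ¬ (7 : GaussianInt) ∣ c ∧
        (x = ℘[ofUpperHalfPlane UpperHalfPlane.I] (((c : GaussianInt) : ℂ) / 7) / ((Real.Gamma (1 / 4) ^ 2 / (2 * Real.sqrt (2 * Real.pi)) : ℝ) : ℂ) ^ 2 ∨
         x = ℘'[ofUpperHalfPlane UpperHalfPlane.I] (((c : GaussianInt) : ℂ) / 7) / (2 * ((Real.Gamma (1 / 4) ^ 2 / (2 * Real.sqrt (2 * Real.pi)) : ℝ) : ℂ) ^ 3))}) ≃ₐ[ℚ⟮I⟯]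
             (IntermediateField.adjoin ℚ⟮I⟯ {x : ℂ | ∃ c : GaussianInt, ¬ (7 : GaussianInt) ∣ c ∧
        (x = ℘[ofUpperHalfPlane UpperHalfPlane.I] (((c : GaussianInt) : ℂ) / 7) / ((Real.Gamma (1 / 4) ^ 2 / (2 * Real.sqrt (2 * Real.pi)) : ℝ) : ℂ) ^ 2 ∨
         x = ℘'[ofUpperHalfPlane UpperHalfPlane.I] (((c : GaussianInt) : ℂ) / 7) / (2 * ((Real.Gamma (1 / 4) ^ 2 / (2 * Real.sqrt (2 * Real.pi)) : ℝ) : ℂ) ^ 3))})} {u w : GaussianInt}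
    (hσ : ∀ (c : GaussianInt) (hc : ¬ (7 : GaussianInt) ∣ c),
      ((σ ⟨_, X_mem_adjoin hc⟩ : (IntermediateField.adjoin ℚ⟮I⟯ {x : ℂ | ∃ c : GaussianInt, ¬ (7 : GaussianInt) ∣ c ∧
        (x = ℘[ofUpperHalfPlane UpperHalfPlane.I] (((c : GaussianInt) : ℂ) / 7) / ((Real.Gamma (1 / 4) ^ 2 / (2 * Real.sqrt (2 * Real.pi)) : ℝ) : ℂ) ^ 2 ∨
         x = ℘'[ofUpperHalfPlane UpperHalfPlane.I] (((c : GaussianInt) : ℂ) / 7) / (2 * ((Real.Gamma (1 / 4) ^ 2 / (2 * Real.sqrt (2 * Real.pi)) : ℝ) : ℂ) ^ 3))})) : ℂ) =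
             ℘[ofUpperHalfPlane UpperHalfPlane.I] (((u * c : GaussianInt) : ℂ) / 7) / ((Real.Gamma (1 / 4) ^ 2 / (2 * Real.sqrt (2 * Real.pi)) : ℝ) : ℂ) ^ 2 ∧
      ((σ ⟨_, Y_mem_adjoin hc⟩ : (IntermediateField.adjoin ℚ⟮I⟯ {x : ℂ | ∃ c : GaussianInt, ¬ (7 : GaussianInt) ∣ c ∧
        (x = ℘[ofUpperHalfPlane UpperHalfPlane.I] (((c : GaussianInt) : ℂ) / 7) / ((Real.Gamma (1 / 4) ^ 2 / (2 * Real.sqrt (2 * Real.pi)) : ℝ) : ℂ) ^ 2 ∨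
         x = ℘'[ofUpperHalfPlane UpperHalfPlane.I] (((c : GaussianInt) : ℂ) / 7) / (2 * ((Real.Gamma (1 / 4) ^ 2 / (2 * Real.sqrt (2 * Real.pi)) : ℝ) : ℂ) ^ 3))})) : ℂ) =
             ℘'[ofUpperHalfPlane UpperHalfPlane.I] (((u * c : GaussianInt) : ℂ) / 7) / (2 * ((Real.Gamma (1 / 4) ^ 2 / (2 * Real.sqrt (2 * Real.pi)) : ℝ) : ℂ) ^ 3))
    (hτ : ∀ (c : GaussianInt) (hc : ¬ (7 : GaussianInt) ∣ c),
      ((τ ⟨_, X_mem_adjoin hc⟩ : (IntermediateField.adjoin ℚ⟮I⟯ {x : ℂ | ∃ c : GaussianInt, ¬ (7 : GaussianInt) ∣ c ∧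
        (x = ℘[ofUpperHalfPlane UpperHalfPlane.I] (((c : GaussianInt) : ℂ) / 7) / ((Real.Gamma (1 / 4) ^ 2 / (2 * Real.sqrt (2 * Real.pi)) : ℝ) : ℂ) ^ 2 ∨
         x = ℘'[ofUpperHalfPlane UpperHalfPlane.I] (((c : GaussianInt) : ℂ) / 7) / (2 * ((Real.Gamma (1 / 4) ^ 2 / (2 * Real.sqrt (2 * Real.pi)) : ℝ) : ℂ) ^ 3))})) : ℂ) =
             ℘[ofUpperHalfPlane UpperHalfPlane.I] (((w * c : GaussianInt) : ℂ) / 7) / ((Real.Gamma (1 / 4) ^ 2 / (2 * Real.sqrt (2 * Real.pi)) : ℝ) : ℂ) ^ 2 ∧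
      ((τ ⟨_, Y_mem_adjoin hc⟩ : (IntermediateField.adjoin ℚ⟮I⟯ {x : ℂ | ∃ c : GaussianInt, ¬ (7 : GaussianInt) ∣ c ∧
        (x = ℘[ofUpperHalfPlane UpperHalfPlane.I] (((c : GaussianInt) : ℂ) / 7) / ((Real.Gamma (1 / 4) ^ 2 / (2 * Real.sqrt (2 * Real.pi)) : ℝ) : ℂ) ^ 2 ∨
         x = ℘'[ofUpperHalfPlane UpperHalfPlane.I] (((c : GaussianInt) : ℂ) / 7) / (2 * ((Real.Gamma (1 / 4) ^ 2 / (2 * Real.sqrt (2 * Real.pi)) : ℝ) : ℂ) ^ 3))})) : ℂ) =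
             ℘'[ofUpperHalfPlane UpperHalfPlane.I] (((w * c : GaussianInt) : ℂ) / 7) / (2 * ((Real.Gamma (1 / 4) ^ 2 / (2 * Real.sqrt (2 * Real.pi)) : ℝ) : ℂ) ^ 3))
    (huw : (7 : GaussianInt) ∣ u - w) : σ = τ := by
  apply AlgEquiv.ext
  intro x
  apply Subtype.ext
  obtain ⟨x, hx⟩ := x
  induction hx using IntermediateField.adjoin_induction with
  | mem x hx =>
    obtain ⟨c, hc, rfl | rfl⟩ := hx
    · rw [(hσ c hc).1, (hτ c hc).1]
      exact (X_Y_eq_of_dvd_sub (show (7 : GaussianInt) ∣ u * c - w * c by rw [← sub_mul]; exact Dvd.dvd.mul_right huw c)).1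
    · rw [(hσ c hc).2, (hτ c hc).2]
      exact (X_Y_eq_of_dvd_sub (show (7 : GaussianInt) ∣ u * c - w * c by rw [← sub_mul]; exact Dvd.dvd.mul_right huw c)).2
  | algebraMap a =>
    change ((σ (algebraMap ℚ⟮I⟯ _ a) : (IntermediateField.adjoin ℚ⟮I⟯ {x : ℂ | ∃ c : GaussianInt, ¬ (7 : GaussianInt) ∣ c ∧
        (x = ℘[ofUpperHalfPlane UpperHalfPlane.I] (((c : GaussianInt) : ℂ) / 7) / ((Real.Gamma (1 / 4) ^ 2 / (2 * Real.sqrt (2 * Real.pi)) : ℝ) : ℂ) ^ 2 ∨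
         x = ℘'[ofUpperHalfPlane UpperHalfPlane.I] (((c : GaussianInt) : ℂ) / 7) / (2 * ((Real.Gamma (1 / 4) ^ 2 / (2 * Real.sqrt (2 * Real.pi)) : ℝ) : ℂ) ^ 3))})) : ℂ) =
             ((τ (algebraMap ℚ⟮I⟯ _ a) : (IntermediateField.adjoin ℚ⟮I⟯ {x : ℂ | ∃ c : GaussianInt, ¬ (7 : GaussianInt) ∣ c ∧
        (x = ℘[ofUpperHalfPlane UpperHalfPlane.I] (((c : GaussianInt) : ℂ) / 7) / ((Real.Gamma (1 / 4) ^ 2 / (2 * Real.sqrt (2 * Real.pi)) : ℝ) : ℂ) ^ 2 ∨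
         x = ℘'[ofUpperHalfPlane UpperHalfPlane.I] (((c : GaussianInt) : ℂ) / 7) / (2 * ((Real.Gamma (1 / 4) ^ 2 / (2 * Real.sqrt (2 * Real.pi)) : ℝ) : ℂ) ^ 3))})) : ℂ)
    rw [σ.commutes, τ.commutes]
  | add x y hx hy ihx ihy =>
    change ((σ (⟨x, hx⟩ + ⟨y, hy⟩) : (IntermediateField.adjoin ℚ⟮I⟯ {x : ℂ | ∃ c : GaussianInt, ¬ (7 : GaussianInt) ∣ c ∧
        (x = ℘[ofUpperHalfPlane UpperHalfPlane.I] (((c : GaussianInt) : ℂ) / 7) / ((Real.Gamma (1 / 4) ^ 2 / (2 * Real.sqrt (2 * Real.pi)) : ℝ) : ℂ) ^ 2 ∨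
         x = ℘'[ofUpperHalfPlane UpperHalfPlane.I] (((c : GaussianInt) : ℂ) / 7) / (2 * ((Real.Gamma (1 / 4) ^ 2 / (2 * Real.sqrt (2 * Real.pi)) : ℝ) : ℂ) ^ 3))})) : ℂ) =
             ((τ (⟨x, hx⟩ + ⟨y, hy⟩) : (IntermediateField.adjoin ℚ⟮I⟯ {x : ℂ | ∃ c : GaussianInt, ¬ (7 : GaussianInt) ∣ c ∧
        (x = ℘[ofUpperHalfPlane UpperHalfPlane.I] (((c : GaussianInt) : ℂ) / 7) / ((Real.Gamma (1 / 4) ^ 2 / (2 * Real.sqrt (2 * Real.pi)) : ℝ) : ℂ) ^ 2 ∨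
         x = ℘'[ofUpperHalfPlane UpperHalfPlane.I] (((c : GaussianInt) : ℂ) / 7) / (2 * ((Real.Gamma (1 / 4) ^ 2 / (2 * Real.sqrt (2 * Real.pi)) : ℝ) : ℂ) ^ 3))})) : ℂ)
    rw [map_add, map_add]
    push_cast
    rw [ihx, ihy]
  | inv x hx ihx =>
    change ((σ ((⟨x, hx⟩)⁻¹) : (IntermediateField.adjoin ℚ⟮I⟯ {x : ℂ | ∃ c : GaussianInt, ¬ (7 : GaussianInt) ∣ c ∧
        (x = ℘[ofUpperHalfPlane UpperHalfPlane.I] (((c : GaussianInt) : ℂ) / 7) / ((Real.Gamma (1 / 4) ^ 2 / (2 * Real.sqrt (2 * Real.pi)) : ℝ) : ℂ) ^ 2 ∨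
         x = ℘'[ofUpperHalfPlane UpperHalfPlane.I] (((c : GaussianInt) : ℂ) / 7) / (2 * ((Real.Gamma (1 / 4) ^ 2 / (2 * Real.sqrt (2 * Real.pi)) : ℝ) : ℂ) ^ 3))})) : ℂ) =
             ((τ ((⟨x, hx⟩)⁻¹) : (IntermediateField.adjoin ℚ⟮I⟯ {x : ℂ | ∃ c : GaussianInt, ¬ (7 : GaussianInt) ∣ c ∧
        (x = ℘[ofUpperHalfPlane UpperHalfPlane.I] (((c : GaussianInt) : ℂ) / 7) / ((Real.Gamma (1 / 4) ^ 2 / (2 * Real.sqrt (2 * Real.pi)) : ℝ) : ℂ) ^ 2 ∨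
         x = ℘'[ofUpperHalfPlane UpperHalfPlane.I] (((c : GaussianInt) : ℂ) / 7) / (2 * ((Real.Gamma (1 / 4) ^ 2 / (2 * Real.sqrt (2 * Real.pi)) : ℝ) : ℂ) ^ 3))})) : ℂ)
    rw [map_inv₀, map_inv₀]
    push_cast
    rw [ihx]
  | mul x y hx hy ihx ihy =>
    change ((σ (⟨x, hx⟩ * ⟨y, hy⟩) : (IntermediateField.adjoin ℚ⟮I⟯ {x : ℂ | ∃ c : GaussianInt, ¬ (7 : GaussianInt) ∣ c ∧
        (x = ℘[ofUpperHalfPlane UpperHalfPlane.I] (((c : GaussianInt) : ℂ) / 7) / ((Real.Gamma (1 / 4) ^ 2 / (2 * Real.sqrt (2 * Real.pi)) : ℝ) : ℂ) ^ 2 ∨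
         x = ℘'[ofUpperHalfPlane UpperHalfPlane.I] (((c : GaussianInt) : ℂ) / 7) / (2 * ((Real.Gamma (1 / 4) ^ 2 / (2 * Real.sqrt (2 * Real.pi)) : ℝ) : ℂ) ^ 3))})) : ℂ) =
             ((τ (⟨x, hx⟩ * ⟨y, hy⟩) : (IntermediateField.adjoin ℚ⟮I⟯ {x : ℂ | ∃ c : GaussianInt, ¬ (7 : GaussianInt) ∣ c ∧
        (x = ℘[ofUpperHalfPlane UpperHalfPlane.I] (((c : GaussianInt) : ℂ) / 7) / ((Real.Gamma (1 / 4) ^ 2 / (2 * Real.sqrt (2 * Real.pi)) : ℝ) : ℂ) ^ 2 ∨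
         x = ℘'[ofUpperHalfPlane UpperHalfPlane.I] (((c : GaussianInt) : ℂ) / 7) / (2 * ((Real.Gamma (1 / 4) ^ 2 / (2 * Real.sqrt (2 * Real.pi)) : ℝ) : ℂ) ^ 3))})) : ℂ)
    rw [map_mul, map_mul]
    push_cast
    rw [ihx, ihy]

section Count

variable {Γ₀ : Type*} [LinearOrderedCommGroupWithZero Γ₀] (v : Valuation ℂ Γ₀)

/-- **`[K₇ : ℚ(i)] ≥ 48`**: `1, t_1, …, t_1⁴⁷` (`t_1 = X_1/Y_1 ∈ K₇`) are linearly independent over `ℚ⟮i⟯` — a non-trivial relation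
`Σ a_j t_1^j = 0` is impossible because the terms have pairwise distinct valuations (`v(a_j) ∈ v(7)^ℤ = v(t_1)^{48ℤ}`).
[cite: Serre1979, Ch. I §6 Prop. 17–18] -/
theorem linearIndependent_pow (h7 : v 7 < 1) :
    LinearIndependent ℚ⟮I⟯ (fun j : Fin 48 ↦
      ((⟨_, X_mem_adjoin not_seven_dvd_one⟩ : (IntermediateField.adjoin ℚ⟮I⟯ {x : ℂ | ∃ c : GaussianInt, ¬ (7 : GaussianInt) ∣ c ∧
        (x = ℘[ofUpperHalfPlane UpperHalfPlane.I] (((c : GaussianInt) : ℂ) / 7) / ((Real.Gamma (1 / 4) ^ 2 / (2 * Real.sqrt (2 * Real.pi)) : ℝ) : ℂ) ^ 2 ∨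
         x = ℘'[ofUpperHalfPlane UpperHalfPlane.I] (((c : GaussianInt) : ℂ) / 7) / (2 * ((Real.Gamma (1 / 4) ^ 2 / (2 * Real.sqrt (2 * Real.pi)) : ℝ) : ℂ) ^ 3))})) /
             ⟨_, Y_mem_adjoin not_seven_dvd_one⟩) ^ (j : ℕ)) := by
  rw [Fintype.linearIndependent_iff]
  intro g hg j
  set eX : (IntermediateField.adjoin ℚ⟮I⟯ {x : ℂ | ∃ c : GaussianInt, ¬ (7 : GaussianInt) ∣ c ∧
        (x = ℘[ofUpperHalfPlane UpperHalfPlane.I] (((c : GaussianInt) : ℂ) / 7) / ((Real.Gamma (1 / 4) ^ 2 / (2 * Real.sqrt (2 * Real.pi)) : ℝ) : ℂ) ^ 2 ∨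
         x = ℘'[ofUpperHalfPlane UpperHalfPlane.I] (((c : GaussianInt) : ℂ) / 7) / (2 * ((Real.Gamma (1 / 4) ^ 2 / (2 * Real.sqrt (2 * Real.pi)) : ℝ) : ℂ) ^ 3))}) :=
             ⟨_, X_mem_adjoin not_seven_dvd_one⟩ with heX
  set eY : (IntermediateField.adjoin ℚ⟮I⟯ {x : ℂ | ∃ c : GaussianInt, ¬ (7 : GaussianInt) ∣ c ∧
        (x = ℘[ofUpperHalfPlane UpperHalfPlane.I] (((c : GaussianInt) : ℂ) / 7) / ((Real.Gamma (1 / 4) ^ 2 / (2 * Real.sqrt (2 * Real.pi)) : ℝ) : ℂ) ^ 2 ∨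
         x = ℘'[ofUpperHalfPlane UpperHalfPlane.I] (((c : GaussianInt) : ℂ) / 7) / (2 * ((Real.Gamma (1 / 4) ^ 2 / (2 * Real.sqrt (2 * Real.pi)) : ℝ) : ℂ) ^ 3))}) :=
             ⟨_, Y_mem_adjoin not_seven_dvd_one⟩ with heY
  -- push the relation to `ℂ`
  have hsum : ∑ i : Fin 48, (((g i : ℚ⟮I⟯) : ℂ)) * ((eX : ℂ) / (eY : ℂ)) ^ (i : ℕ) = 0 := by
    have h := congrArg (fun x : (IntermediateField.adjoin ℚ⟮I⟯ {x : ℂ | ∃ c : GaussianInt, ¬ (7 : GaussianInt) ∣ c ∧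
        (x = ℘[ofUpperHalfPlane UpperHalfPlane.I] (((c : GaussianInt) : ℂ) / 7) / ((Real.Gamma (1 / 4) ^ 2 / (2 * Real.sqrt (2 * Real.pi)) : ℝ) : ℂ) ^ 2 ∨
         x = ℘'[ofUpperHalfPlane UpperHalfPlane.I] (((c : GaussianInt) : ℂ) / 7) / (2 * ((Real.Gamma (1 / 4) ^ 2 / (2 * Real.sqrt (2 * Real.pi)) : ℝ) : ℂ) ^ 3))}) ↦ (x : ℂ)) hg
    push_cast at h
    rw [← h]
    refine Finset.sum_congr rfl fun i _ ↦ ?_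
    rw [Algebra.smul_def]
    rfl
  -- valuation data: `r = v(t_1)`, `0 < r < 1`, `r⁴⁸ = v 7`
  obtain ⟨hr0, hr1⟩ := val_t_lt_one v h7 not_seven_dvd_one
  have hr48 := (val_division v h7 not_seven_dvd_one).2.2.2
  have ha : ∀ i : Fin 48, (((g i : ℚ⟮I⟯) : ℂ)) = 0 ∨ ∃ m : ℤ, v (((g i : ℚ⟮I⟯) : ℂ)) =
      v ((eX : ℂ) / (eY : ℂ)) ^ (((48 : ℕ) : ℤ) * m) := by
    intro i
    by_cases h0 : (((g i : ℚ⟮I⟯) : ℂ)) = 0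
    · exact Or.inl h0
    · right
      obtain ⟨m, hm⟩ := exists_val_eq_zpow_of_mem_adjoin_I v h7 (g i).2 h0
      refine ⟨m, ?_⟩
      rw [hm, zpow_mul, zpow_natCast]
      exact congrArg (· ^ m) hr48.symm
  have hgi := eq_zero_of_sum_mul_pow_eq_zero v hr0 hr1 rfl (fun i ↦ (((g i : ℚ⟮I⟯) : ℂ))) ha hsum j
  exact Subtype.ext hgi

/-- `[K₇ : ℚ(i)] ≥ 48`. [cite: Serre1979, Ch. I §6 Prop. 18] -/
theorem finrank_ge (h7 : v 7 < 1) : 48 ≤ Module.finrank ℚ⟮I⟯ (IntermediateField.adjoin ℚ⟮I⟯ {x : ℂ | ∃ c : GaussianInt, ¬ (7 : GaussianInt) ∣ c ∧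
        (x = ℘[ofUpperHalfPlane UpperHalfPlane.I] (((c : GaussianInt) : ℂ) / 7) / ((Real.Gamma (1 / 4) ^ 2 / (2 * Real.sqrt (2 * Real.pi)) : ℝ) : ℂ) ^ 2 ∨
         x = ℘'[ofUpperHalfPlane UpperHalfPlane.I] (((c : GaussianInt) : ℂ) / 7) / (2 * ((Real.Gamma (1 / 4) ^ 2 / (2 * Real.sqrt (2 * Real.pi)) : ℝ) : ℂ) ^ 3))}) := by
  haveI := finiteDimensional_adjoin
  have h := (linearIndependent_pow v h7).fintype_card_le_finrank
  simpa using h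

/-- ★ **`|Gal(K₇/ℚ(i))| = [K₇ : ℚ(i)] = 48`, and `σ ↦ u_σ` hits every class of `(ℤ[i]/7)ˣ`.** The map `σ ↦ (u_σ mod 7)` is injective
into the `48` non-zero classes of `ℤ[i]/7` (`algEquiv_eq_of_dvd_sub`) while `|Gal| = [K₇ : ℚ(i)] ≥ 48` (`finrank_ge`, `K₇/ℚ(i)` Galois);
so it is a bijection: for every `w ∉ 7ℤ[i]` some `σ` acts as `P_c ↦ P_{wc}`. [cite: SilvermanATAEC1994, II.5 Thm. 5.6] -/
theorem card_algEquiv (h7 : v 7 < 1) :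
    Nat.card ((IntermediateField.adjoin ℚ⟮I⟯ {x : ℂ | ∃ c : GaussianInt, ¬ (7 : GaussianInt) ∣ c ∧
        (x = ℘[ofUpperHalfPlane UpperHalfPlane.I] (((c : GaussianInt) : ℂ) / 7) / ((Real.Gamma (1 / 4) ^ 2 / (2 * Real.sqrt (2 * Real.pi)) : ℝ) : ℂ) ^ 2 ∨
         x = ℘'[ofUpperHalfPlane UpperHalfPlane.I] (((c : GaussianInt) : ℂ) / 7) / (2 * ((Real.Gamma (1 / 4) ^ 2 / (2 * Real.sqrt (2 * Real.pi)) : ℝ) : ℂ) ^ 3))}) ≃ₐ[ℚ⟮I⟯]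
             (IntermediateField.adjoin ℚ⟮I⟯ {x : ℂ | ∃ c : GaussianInt, ¬ (7 : GaussianInt) ∣ c ∧
        (x = ℘[ofUpperHalfPlane UpperHalfPlane.I] (((c : GaussianInt) : ℂ) / 7) / ((Real.Gamma (1 / 4) ^ 2 / (2 * Real.sqrt (2 * Real.pi)) : ℝ) : ℂ) ^ 2 ∨
         x = ℘'[ofUpperHalfPlane UpperHalfPlane.I] (((c : GaussianInt) : ℂ) / 7) / (2 * ((Real.Gamma (1 / 4) ^ 2 / (2 * Real.sqrt (2 * Real.pi)) : ℝ) : ℂ) ^ 3))})) = 48 ∧ Module.finrank ℚ⟮I⟯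
             (IntermediateField.adjoin ℚ⟮I⟯ {x : ℂ | ∃ c : GaussianInt, ¬ (7 : GaussianInt) ∣ c ∧
        (x = ℘[ofUpperHalfPlane UpperHalfPlane.I] (((c : GaussianInt) : ℂ) / 7) / ((Real.Gamma (1 / 4) ^ 2 / (2 * Real.sqrt (2 * Real.pi)) : ℝ) : ℂ) ^ 2 ∨
         x = ℘'[ofUpperHalfPlane UpperHalfPlane.I] (((c : GaussianInt) : ℂ) / 7) / (2 * ((Real.Gamma (1 / 4) ^ 2 / (2 * Real.sqrt (2 * Real.pi)) : ℝ) : ℂ) ^ 3))}) = 48 ∧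
    ∀ w : GaussianInt, ¬ (7 : GaussianInt) ∣ w → ∃ σ : (IntermediateField.adjoin ℚ⟮I⟯ {x : ℂ | ∃ c : GaussianInt, ¬ (7 : GaussianInt) ∣ c ∧
        (x = ℘[ofUpperHalfPlane UpperHalfPlane.I] (((c : GaussianInt) : ℂ) / 7) / ((Real.Gamma (1 / 4) ^ 2 / (2 * Real.sqrt (2 * Real.pi)) : ℝ) : ℂ) ^ 2 ∨
         x = ℘'[ofUpperHalfPlane UpperHalfPlane.I] (((c : GaussianInt) : ℂ) / 7) / (2 * ((Real.Gamma (1 / 4) ^ 2 / (2 * Real.sqrt (2 * Real.pi)) : ℝ) : ℂ) ^ 3))}) ≃ₐ[ℚ⟮I⟯]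
             (IntermediateField.adjoin ℚ⟮I⟯ {x : ℂ | ∃ c : GaussianInt, ¬ (7 : GaussianInt) ∣ c ∧
        (x = ℘[ofUpperHalfPlane UpperHalfPlane.I] (((c : GaussianInt) : ℂ) / 7) / ((Real.Gamma (1 / 4) ^ 2 / (2 * Real.sqrt (2 * Real.pi)) : ℝ) : ℂ) ^ 2 ∨
         x = ℘'[ofUpperHalfPlane UpperHalfPlane.I] (((c : GaussianInt) : ℂ) / 7) / (2 * ((Real.Gamma (1 / 4) ^ 2 / (2 * Real.sqrt (2 * Real.pi)) : ℝ) : ℂ) ^ 3))}),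
      ∀ (c : GaussianInt) (hc : ¬ (7 : GaussianInt) ∣ c),
        ((σ ⟨_, X_mem_adjoin hc⟩ : (IntermediateField.adjoin ℚ⟮I⟯ {x : ℂ | ∃ c : GaussianInt, ¬ (7 : GaussianInt) ∣ c ∧
        (x = ℘[ofUpperHalfPlane UpperHalfPlane.I] (((c : GaussianInt) : ℂ) / 7) / ((Real.Gamma (1 / 4) ^ 2 / (2 * Real.sqrt (2 * Real.pi)) : ℝ) : ℂ) ^ 2 ∨
         x = ℘'[ofUpperHalfPlane UpperHalfPlane.I] (((c : GaussianInt) : ℂ) / 7) / (2 * ((Real.Gamma (1 / 4) ^ 2 / (2 * Real.sqrt (2 * Real.pi)) : ℝ) : ℂ) ^ 3))})) : ℂ) =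
             ℘[ofUpperHalfPlane UpperHalfPlane.I] (((w * c : GaussianInt) : ℂ) / 7) / ((Real.Gamma (1 / 4) ^ 2 / (2 * Real.sqrt (2 * Real.pi)) : ℝ) : ℂ) ^ 2 ∧
        ((σ ⟨_, Y_mem_adjoin hc⟩ : (IntermediateField.adjoin ℚ⟮I⟯ {x : ℂ | ∃ c : GaussianInt, ¬ (7 : GaussianInt) ∣ c ∧
        (x = ℘[ofUpperHalfPlane UpperHalfPlane.I] (((c : GaussianInt) : ℂ) / 7) / ((Real.Gamma (1 / 4) ^ 2 / (2 * Real.sqrt (2 * Real.pi)) : ℝ) : ℂ) ^ 2 ∨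
         x = ℘'[ofUpperHalfPlane UpperHalfPlane.I] (((c : GaussianInt) : ℂ) / 7) / (2 * ((Real.Gamma (1 / 4) ^ 2 / (2 * Real.sqrt (2 * Real.pi)) : ℝ) : ℂ) ^ 3))})) : ℂ) =
             ℘'[ofUpperHalfPlane UpperHalfPlane.I] (((w * c : GaussianInt) : ℂ) / 7) / (2 * ((Real.Gamma (1 / 4) ^ 2 / (2 * Real.sqrt (2 * Real.pi)) : ℝ) : ℂ) ^ 3) := by
  haveI := finiteDimensional_adjoin
  haveI := isGalois_adjoin
  have hcard : Fintype.card ((IntermediateField.adjoin ℚ⟮I⟯ {x : ℂ | ∃ c : GaussianInt, ¬ (7 : GaussianInt) ∣ c ∧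
        (x = ℘[ofUpperHalfPlane UpperHalfPlane.I] (((c : GaussianInt) : ℂ) / 7) / ((Real.Gamma (1 / 4) ^ 2 / (2 * Real.sqrt (2 * Real.pi)) : ℝ) : ℂ) ^ 2 ∨
         x = ℘'[ofUpperHalfPlane UpperHalfPlane.I] (((c : GaussianInt) : ℂ) / 7) / (2 * ((Real.Gamma (1 / 4) ^ 2 / (2 * Real.sqrt (2 * Real.pi)) : ℝ) : ℂ) ^ 3))}) ≃ₐ[ℚ⟮I⟯]
             (IntermediateField.adjoin ℚ⟮I⟯ {x : ℂ | ∃ c : GaussianInt, ¬ (7 : GaussianInt) ∣ c ∧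
        (x = ℘[ofUpperHalfPlane UpperHalfPlane.I] (((c : GaussianInt) : ℂ) / 7) / ((Real.Gamma (1 / 4) ^ 2 / (2 * Real.sqrt (2 * Real.pi)) : ℝ) : ℂ) ^ 2 ∨
         x = ℘'[ofUpperHalfPlane UpperHalfPlane.I] (((c : GaussianInt) : ℂ) / 7) / (2 * ((Real.Gamma (1 / 4) ^ 2 / (2 * Real.sqrt (2 * Real.pi)) : ℝ) : ℂ) ^ 3))})) = Module.finrank ℚ⟮I⟯
             (IntermediateField.adjoin ℚ⟮I⟯ {x : ℂ | ∃ c : GaussianInt, ¬ (7 : GaussianInt) ∣ c ∧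
        (x = ℘[ofUpperHalfPlane UpperHalfPlane.I] (((c : GaussianInt) : ℂ) / 7) / ((Real.Gamma (1 / 4) ^ 2 / (2 * Real.sqrt (2 * Real.pi)) : ℝ) : ℂ) ^ 2 ∨
         x = ℘'[ofUpperHalfPlane UpperHalfPlane.I] (((c : GaussianInt) : ℂ) / 7) / (2 * ((Real.Gamma (1 / 4) ^ 2 / (2 * Real.sqrt (2 * Real.pi)) : ℝ) : ℂ) ^ 3))}) := by
    rw [← Nat.card_eq_fintype_card]; exact IsGalois.card_aut_eq_finrank _ _
  have hge := finrank_ge v h7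
  -- the class map
  choose u hu husp using fun σ : (IntermediateField.adjoin ℚ⟮I⟯ {x : ℂ | ∃ c : GaussianInt, ¬ (7 : GaussianInt) ∣ c ∧
        (x = ℘[ofUpperHalfPlane UpperHalfPlane.I] (((c : GaussianInt) : ℂ) / 7) / ((Real.Gamma (1 / 4) ^ 2 / (2 * Real.sqrt (2 * Real.pi)) : ℝ) : ℂ) ^ 2 ∨
         x = ℘'[ofUpperHalfPlane UpperHalfPlane.I] (((c : GaussianInt) : ℂ) / 7) / (2 * ((Real.Gamma (1 / 4) ^ 2 / (2 * Real.sqrt (2 * Real.pi)) : ℝ) : ℂ) ^ 3))}) ≃ₐ[ℚ⟮I⟯]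
             (IntermediateField.adjoin ℚ⟮I⟯ {x : ℂ | ∃ c : GaussianInt, ¬ (7 : GaussianInt) ∣ c ∧
        (x = ℘[ofUpperHalfPlane UpperHalfPlane.I] (((c : GaussianInt) : ℂ) / 7) / ((Real.Gamma (1 / 4) ^ 2 / (2 * Real.sqrt (2 * Real.pi)) : ℝ) : ℂ) ^ 2 ∨
         x = ℘'[ofUpperHalfPlane UpperHalfPlane.I] (((c : GaussianInt) : ℂ) / 7) / (2 * ((Real.Gamma (1 / 4) ^ 2 / (2 * Real.sqrt (2 * Real.pi)) : ℝ) : ℂ) ^ 3))}) ↦ exists_mul_of_algEquiv σ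
  let Θ : ((IntermediateField.adjoin ℚ⟮I⟯ {x : ℂ | ∃ c : GaussianInt, ¬ (7 : GaussianInt) ∣ c ∧
        (x = ℘[ofUpperHalfPlane UpperHalfPlane.I] (((c : GaussianInt) : ℂ) / 7) / ((Real.Gamma (1 / 4) ^ 2 / (2 * Real.sqrt (2 * Real.pi)) : ℝ) : ℂ) ^ 2 ∨
         x = ℘'[ofUpperHalfPlane UpperHalfPlane.I] (((c : GaussianInt) : ℂ) / 7) / (2 * ((Real.Gamma (1 / 4) ^ 2 / (2 * Real.sqrt (2 * Real.pi)) : ℝ) : ℂ) ^ 3))}) ≃ₐ[ℚ⟮I⟯]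
             (IntermediateField.adjoin ℚ⟮I⟯ {x : ℂ | ∃ c : GaussianInt, ¬ (7 : GaussianInt) ∣ c ∧
        (x = ℘[ofUpperHalfPlane UpperHalfPlane.I] (((c : GaussianInt) : ℂ) / 7) / ((Real.Gamma (1 / 4) ^ 2 / (2 * Real.sqrt (2 * Real.pi)) : ℝ) : ℂ) ^ 2 ∨
         x = ℘'[ofUpperHalfPlane UpperHalfPlane.I] (((c : GaussianInt) : ℂ) / 7) / (2 * ((Real.Gamma (1 / 4) ^ 2 / (2 * Real.sqrt (2 * Real.pi)) : ℝ) : ℂ) ^ 3))})) →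
             {b : ZMod 7 × ZMod 7 // b ≠ 0} := fun σ ↦
    ⟨cls 7 (u σ), fun h ↦ hu σ (by
      have h1 := (cls_eq_cls_iff 7 (u σ) 0).mp (h.trans (show (0 : ZMod 7 × ZMod 7) = cls 7 0 from Prod.ext (by simp [cls]) (by simp [cls])))
      simpa using h1)⟩
  have hΘ : Function.Injective Θ := by
    intro σ τ h
    have h' : cls 7 (u σ) = cls 7 (u τ) := congrArg Subtype.val h
    have hdvd : (7 : GaussianInt) ∣ u τ - u σ := (cls_eq_cls_iff 7 _ _).mp h'
    exact algEquiv_eq_of_dvd_sub (husp σ) (husp τ) (by rw [← dvd_neg, neg_sub]; exact hdvd)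
  have htarget : Fintype.card {b : ZMod 7 × ZMod 7 // b ≠ 0} = 48 := by decide
  have hle : Fintype.card ((IntermediateField.adjoin ℚ⟮I⟯ {x : ℂ | ∃ c : GaussianInt, ¬ (7 : GaussianInt) ∣ c ∧
        (x = ℘[ofUpperHalfPlane UpperHalfPlane.I] (((c : GaussianInt) : ℂ) / 7) / ((Real.Gamma (1 / 4) ^ 2 / (2 * Real.sqrt (2 * Real.pi)) : ℝ) : ℂ) ^ 2 ∨
         x = ℘'[ofUpperHalfPlane UpperHalfPlane.I] (((c : GaussianInt) : ℂ) / 7) / (2 * ((Real.Gamma (1 / 4) ^ 2 / (2 * Real.sqrt (2 * Real.pi)) : ℝ) : ℂ) ^ 3))}) ≃ₐ[ℚ⟮I⟯]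
             (IntermediateField.adjoin ℚ⟮I⟯ {x : ℂ | ∃ c : GaussianInt, ¬ (7 : GaussianInt) ∣ c ∧
        (x = ℘[ofUpperHalfPlane UpperHalfPlane.I] (((c : GaussianInt) : ℂ) / 7) / ((Real.Gamma (1 / 4) ^ 2 / (2 * Real.sqrt (2 * Real.pi)) : ℝ) : ℂ) ^ 2 ∨
         x = ℘'[ofUpperHalfPlane UpperHalfPlane.I] (((c : GaussianInt) : ℂ) / 7) / (2 * ((Real.Gamma (1 / 4) ^ 2 / (2 * Real.sqrt (2 * Real.pi)) : ℝ) : ℂ) ^ 3))})) ≤ 48 := htarget ▸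
             Fintype.card_le_of_injective Θ hΘ
  have hcard48 : Fintype.card ((IntermediateField.adjoin ℚ⟮I⟯ {x : ℂ | ∃ c : GaussianInt, ¬ (7 : GaussianInt) ∣ c ∧
        (x = ℘[ofUpperHalfPlane UpperHalfPlane.I] (((c : GaussianInt) : ℂ) / 7) / ((Real.Gamma (1 / 4) ^ 2 / (2 * Real.sqrt (2 * Real.pi)) : ℝ) : ℂ) ^ 2 ∨
         x = ℘'[ofUpperHalfPlane UpperHalfPlane.I] (((c : GaussianInt) : ℂ) / 7) / (2 * ((Real.Gamma (1 / 4) ^ 2 / (2 * Real.sqrt (2 * Real.pi)) : ℝ) : ℂ) ^ 3))}) ≃ₐ[ℚ⟮I⟯]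
             (IntermediateField.adjoin ℚ⟮I⟯ {x : ℂ | ∃ c : GaussianInt, ¬ (7 : GaussianInt) ∣ c ∧
        (x = ℘[ofUpperHalfPlane UpperHalfPlane.I] (((c : GaussianInt) : ℂ) / 7) / ((Real.Gamma (1 / 4) ^ 2 / (2 * Real.sqrt (2 * Real.pi)) : ℝ) : ℂ) ^ 2 ∨
         x = ℘'[ofUpperHalfPlane UpperHalfPlane.I] (((c : GaussianInt) : ℂ) / 7) / (2 * ((Real.Gamma (1 / 4) ^ 2 / (2 * Real.sqrt (2 * Real.pi)) : ℝ) : ℂ) ^ 3))})) = 48 := le_antisymm hle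
             (by omega)
  refine ⟨by rw [Nat.card_eq_fintype_card, hcard48], by omega, fun w hw ↦ ?_⟩
  have hbij : Function.Bijective Θ := by
    rw [Fintype.bijective_iff_injective_and_card]
    exact ⟨hΘ, by rw [hcard48, htarget]⟩
  obtain ⟨σ, hσ⟩ := hbij.2 ⟨cls 7 w, fun h ↦ hw (by
      have h1 := (cls_eq_cls_iff 7 w 0).mp (h.trans (show (0 : ZMod 7 × ZMod 7) = cls 7 0 from Prod.ext (by simp [cls]) (by simp [cls])))
      simpa using h1)⟩
  have hcls : cls 7 (u σ) = cls 7 w := congrArg Subtype.val hσ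
  have hdvd : (7 : GaussianInt) ∣ w - u σ := (cls_eq_cls_iff 7 _ _).mp hcls
  refine ⟨σ, fun c hc ↦ ?_⟩
  have h7c : (7 : GaussianInt) ∣ w * c - u σ * c := by rw [← sub_mul]; exact Dvd.dvd.mul_right hdvd c
  obtain ⟨hXe, hYe⟩ := X_Y_eq_of_dvd_sub h7c
  exact ⟨((husp σ) c hc).1.trans hXe.symm, ((husp σ) c hc).2.trans hYe.symm⟩

/-- **The power basis**: every element of `K₇` is `Σ_{j<48} a_j t_1^j` with `a_j ∈ ℚ⟮i⟯` (`48` independent powers in dimension `48`).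
[cite: Serre1979, Ch. I §6 Prop. 18] -/
theorem exists_coeff_pow (h7 : v 7 < 1) (x : (IntermediateField.adjoin ℚ⟮I⟯ {x : ℂ | ∃ c : GaussianInt, ¬ (7 : GaussianInt) ∣ c ∧
        (x = ℘[ofUpperHalfPlane UpperHalfPlane.I] (((c : GaussianInt) : ℂ) / 7) / ((Real.Gamma (1 / 4) ^ 2 / (2 * Real.sqrt (2 * Real.pi)) : ℝ) : ℂ) ^ 2 ∨
         x = ℘'[ofUpperHalfPlane UpperHalfPlane.I] (((c : GaussianInt) : ℂ) / 7) / (2 * ((Real.Gamma (1 / 4) ^ 2 / (2 * Real.sqrt (2 * Real.pi)) : ℝ) : ℂ) ^ 3))})) :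
    ∃ a : Fin 48 → ℚ⟮I⟯, x = ∑ j : Fin 48, a j •
      (((⟨_, X_mem_adjoin not_seven_dvd_one⟩ : (IntermediateField.adjoin ℚ⟮I⟯ {x : ℂ | ∃ c : GaussianInt, ¬ (7 : GaussianInt) ∣ c ∧
        (x = ℘[ofUpperHalfPlane UpperHalfPlane.I] (((c : GaussianInt) : ℂ) / 7) / ((Real.Gamma (1 / 4) ^ 2 / (2 * Real.sqrt (2 * Real.pi)) : ℝ) : ℂ) ^ 2 ∨
         x = ℘'[ofUpperHalfPlane UpperHalfPlane.I] (((c : GaussianInt) : ℂ) / 7) / (2 * ((Real.Gamma (1 / 4) ^ 2 / (2 * Real.sqrt (2 * Real.pi)) : ℝ) : ℂ) ^ 3))})) /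
             ⟨_, Y_mem_adjoin not_seven_dvd_one⟩) ^ (j : ℕ)) := by
  haveI := finiteDimensional_adjoin
  have hli := linearIndependent_pow v h7
  have hfin : Module.finrank ℚ⟮I⟯ (IntermediateField.adjoin ℚ⟮I⟯ {x : ℂ | ∃ c : GaussianInt, ¬ (7 : GaussianInt) ∣ c ∧
        (x = ℘[ofUpperHalfPlane UpperHalfPlane.I] (((c : GaussianInt) : ℂ) / 7) / ((Real.Gamma (1 / 4) ^ 2 / (2 * Real.sqrt (2 * Real.pi)) : ℝ) : ℂ) ^ 2 ∨
         x = ℘'[ofUpperHalfPlane UpperHalfPlane.I] (((c : GaussianInt) : ℂ) / 7) / (2 * ((Real.Gamma (1 / 4) ^ 2 / (2 * Real.sqrt (2 * Real.pi)) : ℝ) : ℂ) ^ 3))}) = 48 := (card_algEquiv v h7).2.1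
  have hspan := hli.span_eq_top_of_card_eq_finrank (by rw [hfin]; simp)
  have hx : x ∈ Submodule.span ℚ⟮I⟯ (Set.range (fun j : Fin 48 ↦
      ((⟨_, X_mem_adjoin not_seven_dvd_one⟩ : (IntermediateField.adjoin ℚ⟮I⟯ {x : ℂ | ∃ c : GaussianInt, ¬ (7 : GaussianInt) ∣ c ∧
        (x = ℘[ofUpperHalfPlane UpperHalfPlane.I] (((c : GaussianInt) : ℂ) / 7) / ((Real.Gamma (1 / 4) ^ 2 / (2 * Real.sqrt (2 * Real.pi)) : ℝ) : ℂ) ^ 2 ∨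
         x = ℘'[ofUpperHalfPlane UpperHalfPlane.I] (((c : GaussianInt) : ℂ) / 7) / (2 * ((Real.Gamma (1 / 4) ^ 2 / (2 * Real.sqrt (2 * Real.pi)) : ℝ) : ℂ) ^ 3))})) /
             ⟨_, Y_mem_adjoin not_seven_dvd_one⟩) ^ (j : ℕ))) := by
    rw [hspan]; exact Submodule.mem_top
  obtain ⟨a, ha⟩ := (Submodule.mem_span_range_iff_exists_fun _).mp hx
  exact ⟨a, ha.symm⟩

end Count

end Summit.BirchSwinnertonDyer.BirchSwinnertonDyer.Theorems.BiquadraticEisensteinDescentManinDatumSupercuspidalCMInertSevenDivisionGaloisCount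

end
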